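import Mathlib.Data.Matrix.ColumnRowPartitioned
import Mathlib.LinearAlgebra.Matrix.ToLinearEquiv
import Mathlib.LinearAlgebra.Matrix.NonsingularInverse
import HarnessLib

/-!
# Route `PhantomRMYoshida`, crux `ResiduallyYoshidaLifting` (stmt-Langlands-13639), line `sector-klingen-split`:
# stub N1-core `stub_greenbergCocycleCore` — the residual linear algebra of the Greenberg condition at `p`

The registered sub-goal `stub_greenbergCocycleCore` of the checked skeleton `Lines/sector_klingen_split.lean` (rev 8, lead
c4-0).  Setting: a field `k`, a family of block upper-triangular `4 × 4` matrices `(S i, B i; 0, S' i)` on `k² ⊕ k²` (the inertia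
elements acting through the non-split residual representation `(σ̄, B; 0, σ̄')`), and a rank-`2` matrix `N' : k² → k² ⊕ k²`
whose column plane is fixed POINTWISE by the family (`(S i, B i; 0, S' i) · N' = N'`, the reduction of the Greenberg plane); some
`S i₀ ≠ 1` and some `S' i₁ ≠ 1`.  Claim: there are `x₁ ≠ 0` fixed by every `S i`, `y₁ ≠ 0` fixed by every `S' i`, and a matrix
`X₀` such that the coboundary-corrected cocycle kills `y₁`: `(B i - (S i X₀ - X₀ S' i)) y₁ = 0` for all `i`.

Proof (elementary, no dimension count).  Write `N' = (P; Q)` with `2 × 2` blocks (`Matrix.fromRows`).  Fixedness reads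
`S i P + B i Q = P` and `S' i Q = Q` (`Matrix.fromBlocks_mul_fromRows`); injectivity of `N'` reads `P a = 0 ∧ Q a = 0 ⇒ a = 0`.
* A square matrix `T ≠ 1` with `T Q = Q` forces `Q` singular (else `T = T Q Q⁻¹ = Q Q⁻¹ = 1`): so `Q c = 0` for some `c ≠ 0`
  (from `S' i₁ ≠ 1`), and `x₁ := P c ≠ 0` (injectivity) has `S i x₁ = (S i P + B i Q) c = P c = x₁`.
* `Q ≠ 0`: otherwise `S i₀ P = P` with `P` injective, contradicting `S i₀ ≠ 1` by the same lemma.  Pick `e` with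
  `y₁ := Q e ≠ 0` and put `x₂ := P e`; then `S' i y₁ = y₁` and `S i x₂ + B i y₁ = x₂`.
* With `X₀ := (-x₂) ⊗ (y₁ j)⁻¹ e_j` for a `j` with `y₁ j ≠ 0` (`Matrix.vecMulVec`), `X₀ y₁ = -x₂`, and
  `(B i - (S i X₀ - X₀ S' i)) y₁ = B i y₁ + S i x₂ - x₂ = 0`.

No new definitions; the one helper lemma is private.  Mathlib only.
-/

noncomputable section

-- `Summit.Langlands.Langlands.…` (summit = sub-problem name, D-0017 layout) trips `dupNamespace` on every decl;
-- project-wide option (lakefile `weak.linter.dupNamespace = false`).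
set_option linter.dupNamespace false
set_option autoImplicit false

open scoped Matrix

namespace Summit.Langlands.Langlands.Cruxes.ResiduallyYoshidaLifting.SectorKlingenSplit.Fibre

variable {k : Type*} [Field k] {n : Type*} [Fintype n] [DecidableEq n]

/-- If a square matrix `T ≠ 1` fixes a square matrix `Q` under left multiplication (`T * Q = Q`), then `Q` is singular:
`Q *ᵥ c = 0` for some `c ≠ 0` (otherwise `det Q ≠ 0` and `T = T Q Q⁻¹ = Q Q⁻¹ = 1`). [folklore] -/
private theorem exists_mulVec_eq_zero_of_mul_eq (T Q : Matrix n n k) (hT : T ≠ 1) (h : T * Q = Q) :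
    ∃ c : n → k, c ≠ 0 ∧ Q *ᵥ c = 0 := by
  by_contra hc
  have hdet : Q.det ≠ 0 := fun h0 ↦ by
    obtain ⟨v, hv, hQv⟩ := Matrix.exists_mulVec_eq_zero_iff.mpr h0
    exact hc ⟨v, hv, hQv⟩
  have hu : IsUnit Q.det := isUnit_iff_ne_zero.mpr hdet
  apply hT
  calc T = T * Q * Q⁻¹ := (Matrix.mul_nonsing_inv_cancel_right Q T hu).symm
    _ = 1 := by rw [h, Matrix.mul_nonsing_inv Q hu]

/-- **Stub N1-core `stub_greenbergCocycleCore`** (the residual linear algebra of the Greenberg–Selmer condition of a realised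
cocycle at `p`): if a plane of `k² ⊕ k²` (column span of a rank-`2` matrix `N'`) is FIXED POINTWISE by a family of block
upper-triangular maps `(S i, B i; 0, S' i)` whose diagonal blocks each move something (`S i₀ ≠ 1`, `S' i₁ ≠ 1`), then the
family `S` fixes some `x₁ ≠ 0`, `S'` fixes some `y₁ ≠ 0`, and after the coboundary change by a suitable `X₀` the cocycle KILLS
`y₁`: `(B i - (S i X₀ - X₀ S' i)) y₁ = 0` for all `i`.  (Blocks `N' = (P; Q)`: `Q` is singular because `S' i₁ ≠ 1` fixes it,
giving `x₁ := P c` for `Q c = 0`, `c ≠ 0`; `Q ≠ 0` because `S i₀ ≠ 1`, giving `y₁ := Q e ≠ 0`, `x₂ := P e` with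
`S i x₂ + B i y₁ = x₂`; any `X₀` with `X₀ y₁ = -x₂` works.) [folklore] -/
theorem stub_greenbergCocycleCore :
    ∀ (k : Type) [Field k] (ι : Type) (S S' B : ι → Matrix (Fin 2) (Fin 2) k)
      (N' : Matrix (Fin 2 ⊕ Fin 2) (Fin 2) k),
      (∀ a : Fin 2 → k, N' *ᵥ a = 0 → a = 0) →
      (∀ i, Matrix.fromBlocks (S i) (B i) 0 (S' i) * N' = N') →
      (∃ i, S i ≠ 1) → (∃ i, S' i ≠ 1) →
      ∃ (X₀ : Matrix (Fin 2) (Fin 2) k) (x₁ y₁ : Fin 2 → k), x₁ ≠ 0 ∧ y₁ ≠ 0 ∧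
        (∀ i, S i *ᵥ x₁ = x₁) ∧ (∀ i, S' i *ᵥ y₁ = y₁) ∧
        ∀ i, (B i - (S i * X₀ - X₀ * S' i)) *ᵥ y₁ = 0 := by
  intro k _ ι S S' B N' hinj hfix hS hS'
  obtain ⟨i₀, hi₀⟩ := hS
  obtain ⟨i₁, hi₁⟩ := hS'
  -- the top and bottom `2 × 2` blocks of `N' = (P; Q)`
  obtain ⟨P, Q, rfl⟩ : ∃ P Q : Matrix (Fin 2) (Fin 2) k, N' = Matrix.fromRows P Q :=
    ⟨N'.toRows₁, N'.toRows₂, (Matrix.fromRows_toRows N').symm⟩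
  -- injectivity and fixedness in terms of the blocks
  have hinj' : ∀ a : Fin 2 → k, P *ᵥ a = 0 → Q *ᵥ a = 0 → a = 0 := fun a hPa hQa ↦ by
    refine hinj a ?_
    rw [Matrix.fromRows_mulVec, hPa, hQa, Sum.elim_zero_zero]
  have hfixP : ∀ i, S i * P + B i * Q = P := fun i ↦ by
    have h := hfix i
    rw [Matrix.fromBlocks_mul_fromRows, Matrix.fromRows_ext_iff] at h
    exact h.1
  have hfixQ : ∀ i, S' i * Q = Q := fun i ↦ by
    have h := hfix i
    rw [Matrix.fromBlocks_mul_fromRows, Matrix.fromRows_ext_iff, Matrix.zero_mul, zero_add] at h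
    exact h.2
  -- (1) `Q` is singular (`S' i₁ ≠ 1` fixes it): `Q c = 0`, `c ≠ 0`; `x₁ := P c ≠ 0` is fixed by every `S i`
  obtain ⟨c, hc, hQc⟩ := exists_mulVec_eq_zero_of_mul_eq (S' i₁) Q hi₁ (hfixQ i₁)
  have hx₁ : P *ᵥ c ≠ 0 := fun h0 ↦ hc (hinj' c h0 hQc)
  have hSx₁ : ∀ i, S i *ᵥ (P *ᵥ c) = P *ᵥ c := fun i ↦ by
    have h := congrArg (fun M : Matrix (Fin 2) (Fin 2) k ↦ M *ᵥ c) (hfixP i)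
    rwa [Matrix.add_mulVec, ← Matrix.mulVec_mulVec, ← Matrix.mulVec_mulVec, hQc, Matrix.mulVec_zero,
      add_zero] at h
  -- (2) `Q ≠ 0` (otherwise `S i₀ ≠ 1` fixes the injective `P`): a column `e` with `y₁ := Q e ≠ 0`; `x₂ := P e`
  have hQ0 : Q ≠ 0 := fun hQ0 ↦ by
    have hSP : S i₀ * P = P := by
      have h := hfixP i₀
      rwa [hQ0, Matrix.mul_zero, add_zero] at h
    obtain ⟨d, hd, hPd⟩ := exists_mulVec_eq_zero_of_mul_eq (S i₀) P hi₀ hSP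
    exact hd (hinj' d hPd (by rw [hQ0, Matrix.zero_mulVec]))
  obtain ⟨e, he⟩ : ∃ e : Fin 2 → k, Q *ᵥ e ≠ 0 := by
    by_contra h
    push Not at h
    exact hQ0 (Matrix.ext_iff_mulVec.mpr fun v ↦ by rw [h v, Matrix.zero_mulVec])
  have hSy₁ : ∀ i, S' i *ᵥ (Q *ᵥ e) = Q *ᵥ e := fun i ↦ by
    rw [Matrix.mulVec_mulVec, hfixQ i]
  have hSx₂ : ∀ i, S i *ᵥ (P *ᵥ e) + B i *ᵥ (Q *ᵥ e) = P *ᵥ e := fun i ↦ by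
    rw [Matrix.mulVec_mulVec, Matrix.mulVec_mulVec, ← Matrix.add_mulVec, hfixP i]
  -- (3) a coboundary matrix `X₀` with `X₀ y₁ = -x₂`
  obtain ⟨j, hj⟩ : ∃ j, (Q *ᵥ e) j ≠ 0 := by
    by_contra h
    push Not at h
    exact he (funext h)
  obtain ⟨X₀, hX₀⟩ : ∃ X₀ : Matrix (Fin 2) (Fin 2) k, X₀ *ᵥ (Q *ᵥ e) = -(P *ᵥ e) :=
    ⟨Matrix.vecMulVec (-(P *ᵥ e)) (Pi.single j ((Q *ᵥ e) j)⁻¹), by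
      rw [Matrix.vecMulVec_mulVec, single_dotProduct, inv_mul_cancel₀ hj, MulOpposite.op_one, one_smul]⟩
  refine ⟨X₀, P *ᵥ c, Q *ᵥ e, hx₁, he, hSx₁, hSy₁, fun i ↦ ?_⟩
  rw [Matrix.sub_mulVec, Matrix.sub_mulVec, ← Matrix.mulVec_mulVec, ← Matrix.mulVec_mulVec, hSy₁ i, hX₀,
    Matrix.mulVec_neg]
  calc B i *ᵥ (Q *ᵥ e) - (-(S i *ᵥ (P *ᵥ e)) - -(P *ᵥ e))
      = S i *ᵥ (P *ᵥ e) + B i *ᵥ (Q *ᵥ e) - P *ᵥ e := by abel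
    _ = 0 := by rw [hSx₂ i, sub_self]

end Summit.Langlands.Langlands.Cruxes.ResiduallyYoshidaLifting.SectorKlingenSplit.Fibre
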